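import Summits.HodgeConjecture.HodgeConjecture.Cruxes.BlochSeedDiscOne.ShellThreeFloorB

/-!
# CompanionBetaStruck — reading β = reading α at every shell, behind the fine door (dual g19; director R19.756)

Token: line stmt-HodgeConjecture-18881 Cruxes/BlochSeedDiscOne/Lines/birth.lean 814a6a70c14e831a stub_rung_pad4_seedAt.
LETTER-MODEL BOOKKEEPING ONLY (`DepthBoundA4.Design`).  Letters ≠ sheaves ≠ SEED; nothing here is proved toward
HC ∕ HC_CM ∕ HC_AV ∕ №4 ∕ 26512 ∕ 18881 ∕ 30548 ∕ H2.  No `axiom` ∕ `sorry` ∕ `instance` ∕ `notation` ∕ `decide`; heights `h`, shells `s` free.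

The kernel rows of `CompanionRows` ((L1)ₛ–(L4)ₛ, (2)ₛ, tier 2) are stated under extremal's binder `NoHook s` and gs-eng-2's `OffLow`.
COMPANION-2S-RULE-N-g18 §0 booked them «α-exact, β-conditional»: in reading β ((M1) assumed, (M2)-P only priced) `NoHook s` for the
OFF-AXIS co-level-`s` letters (F, G at `s = 4`) and `OffLow` were not granted.  sheaf8-1 g7 proved
`FineAxisLift.noOffHubfreeP_of_nHubbed : OnAlphabet h → Disj → RuleDPFine → NHubbed h → NoOffHubfreeP` (R19.756: «(M2₄)-P struck under
(M1₄)»).  This leaf records the two-line consequence the director asked dual to state, with `NoOffHubfreeP` as the displayed INPUT (the farm cannot import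
`FineAxisLift` ∕ `CompanionRows` at the time of writing — lean check rc 75 «stale:unbuilt» ×4, 09:40Z–09:57Z; the composition with sheaf8-1's theorem is the
one-liner `binders_of_noOffHubfreeP (FineAxisLift.noOffHubfreeP_of_nHubbed hD hdisj hfine hN) hE`, to be landed as `binders_of_nHubbed` once the import builds):

* `offLow_of_noOffHubfreeP` : `NoOffHubfreeP D → OffLow D` (vacuously: no hub-free supported P cell has an off-axis letter at all);
* `noHook_of_noOffHubfreeP` : `NoOffHubfreeP D → NoAxisHook s D → NoHook s D`, where `NoAxisHook s` («no hub-free supported P cell has an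
  AXIS letter of co-level `s`», the letter E at `s = 4`) is exactly the part of `NoHook s` that BOXCAP Table A R19.742 (1) supplies in
  BOTH readings (axis hub-free P ⊆ {u⁴, Auuu});
* `binders_of_noOffHubfreeP` : `NoOffHubfreeP` and `NoAxisHook s` give `NoHook s ∧ OffLow` — so, composed with sheaf8-1's theorem, behind the
  fine door (M1) «every supported N cell hubbed» yields BOTH binders of the companion rows, and every row of `CompanionRows` holds in every β-world
  with a fine-closed support.  `NoHook` ∕ `OffLow` are restated here with the SAME BODIES as
  `CompanionRows.NoHook` ∕ `CompanionRows.OffLow` (and extremal's `FamilyLemmaLs` originals), because `CompanionRows` is not built on the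
  farm at the time of writing (lean check rc 75 «stale:unbuilt»); the bridge is `Iff.rfl`, and each row `CompanionRows.R … (hB : NoHook s D) (hO : OffLow D) …`
  becomes `R … (binders_of_nHubbed hD hdis hfine hN hE).1 (…).2 …` verbatim (pattern written out in the HOME copy's §3 comment).

Dependency record: sheaf8-1's kernel theorem (adopted ×1, R19.756) + Table A's E-part as the displayed hypothesis `NoAxisHook`; dual adds none.
-/

set_option linter.dupNamespace false
set_option autoImplicit false

namespace Summit.HodgeConjecture.HodgeConjecture.Cruxes.BlochSeedDiscOne.CompanionBetaStruck

open Summit.HodgeConjecture.HodgeConjecture.Cruxes.BlochSeedDiscOne.DepthBoundA4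
open Summit.HodgeConjecture.HodgeConjecture.Cruxes.BlochSeedDiscOne.ShellThreeFloorB (NoOffHubfreeP)

variable {h s : ℤ} {D : Design}

/-- off-axis letter (verbatim body of `ShellThreeDoorB.OffAxis` = `ShellThreeFloorB.OffAxis` = `FamilyLemmaLs`' use). -/
def OffAxis (ℓ : Letter) : Prop := ℓ.x ≠ 0 ∧ ℓ.y ≠ 0

/-- **NoHookₛ** — verbatim body of `CompanionRows.NoHook` ∕ `FamilyLemmaLs.NoHook`: no hub-free supported P cell contains a letter of co-level `s`. -/
def NoHook (s : ℤ) (D : Design) : Prop :=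
  ∀ x ∈ D.suppP, (∀ f : Fin 4, (x f).colevel ≠ 0) → ∀ f : Fin 4, (x f).colevel ≠ s

/-- **OffLow** — verbatim body of `CompanionRows.OffLow` ∕ `FamilyLemmaLs.OffLow`: in a hub-free supported P cell an off-axis letter forces every
other letter to co-level `≤ 1`. -/
def OffLow (D : Design) : Prop :=
  ∀ x ∈ D.suppP, (∀ f : Fin 4, (x f).colevel ≠ 0) → ∀ k g : Fin 4, k ≠ g → OffAxis (x k) → (x g).colevel ≤ 1

/-- The AXIS part of `NoHook s`: no hub-free supported P cell carries an axis letter of co-level `s` (at `s = 4`: no E in a hub-free P cell).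
This is the E-consequence of BOXCAP Table A (axis hub-free P ⊆ {u⁴, Auuu}), displayed as a hypothesis — Table A itself is a booked table, not a kernel fact. -/
def NoAxisHook (s : ℤ) (D : Design) : Prop :=
  ∀ x ∈ D.suppP, (∀ f : Fin 4, (x f).colevel ≠ 0) → ∀ f : Fin 4, ¬ ShellThreeFloorB.OffAxis (x f) → (x f).colevel ≠ s

/-- The `OffAxis` predicates of the tree (`ShellThreeDoorB` used by `CompanionRows`, `ShellThreeFloorB` used by `NoOffHubfreeP`, the copy above) share one body. -/
theorem offAxis_iff (ℓ : Letter) : OffAxis ℓ ↔ ShellThreeFloorB.OffAxis ℓ := Iff.rfl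

/-- `OffLow` is vacuous once no hub-free supported P cell has an off-axis letter. -/
theorem offLow_of_noOffHubfreeP (hP : NoOffHubfreeP D) : OffLow D := by
  intro x hx hfree k g _hkg hoff
  exact absurd ((offAxis_iff (x k)).1 hoff) (hP x hx hfree k)

/-- `NoHook s` from «hub-free P letters are axis» plus the axis part `NoAxisHook s`. -/
theorem noHook_of_noOffHubfreeP (hP : NoOffHubfreeP D) (hE : NoAxisHook s D) : NoHook s D := by
  intro x hx hfree f
  exact hE x hx hfree f (hP x hx hfree f)

/-- **R19.756, kernel form (dual's half).** «Hub-free P letters are axis» (`NoOffHubfreeP`, = sheaf8-1's corollary of (M1) behind the fine door)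
and the axis part of Table A give BOTH binders of the companion rows: `NoHook s ∧ OffLow`.  Hence reading β = reading α for fine-closed supports,
at every shell `s` and height. -/
theorem binders_of_noOffHubfreeP (hP : NoOffHubfreeP D) (hE : NoAxisHook s D) : NoHook s D ∧ OffLow D :=
  ⟨noHook_of_noOffHubfreeP hP hE, offLow_of_noOffHubfreeP hP⟩

/-- Converse bookkeeping: `NoHook s` contains the axis part (so `NoAxisHook s` is exactly what Table A must supply, nothing more). -/
theorem noAxisHook_of_noHook (hB : NoHook s D) : NoAxisHook s D :=
  fun x hx hfree f _ => hB x hx hfree f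

/-- Scope: bookkeeping on letter designs; no statement about sheaves, seeds or Hodge classes. -/
theorem scope_note : True := trivial

end Summit.HodgeConjecture.HodgeConjecture.Cruxes.BlochSeedDiscOne.CompanionBetaStruck
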